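import Mathlib
import Summits.NavierStokesRegularity.NavierStokesRegularity.Theorems.WakeRatchetTailRatchetPostFiringFrozenWake
import Summits.NavierStokesRegularity.NavierStokesRegularity.Theorems.WakeRatchetTailRatchetPostFiringEnergy
import HarnessLib

/-!
# `WakeRatchet.TailRatchet` (stmt-NavierStokesRegularity-21808), door D4′ — (D′) from quiet times IN THE BAND
# between the energy line and the front (the deep wake is quiet by energy conservation)

Def-free support lemma (MODEL lattice ODEs: the scalar dyadic member of Tao 2016 §1.2 / §4 in the renormalised
variables of §6.4; nothing here concerns the Navier–Stokes equations; stmt-21808 is neither proved nor refuted here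
and no stub of skeleton d00b85951d7c is closed).

`WakeRatchetDyadicPostFiring.postFiringDecay_of_quietTimes` derives the post-firing decay (D′) = (D) of the door
from BOUNDED-DELAY QUIET TIMES: every firing `W_n(σ₁) ≥ c` is followed within log-time `L` by an instant `σ₀` at
which ALL shells `0..n` are `≤ η` (`4Λη ≤ 1`).  By the energy line (`le_of_energy_line`, energy conservation of
the half-line lattice, `Λ > 1`) the shells with `Λ^k e^{−σ₀} √E ≤ η` are `≤ η` at EVERY instant.  Hence it is
enough to produce quiet times for the shells ABOVE the energy line — the band `η e^{σ₀}/√E < Λ^k`, `k ≤ n` — which is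
recorded here as `postFiringDecay_of_bandQuietTimes`.  This is the exact residual content of door D4′ after
`…PostFiringEnergy` (deep wake), `…PostFiringLeadingEdge` (ahead of the front) and `…PostFiringQuench`
(the one-row tools for the band): census CENSUS-21808-leafhand4-g17.md.

HONEST FRAMING: elementary; the band hypothesis is NOT proved here; rung 0.
-/

noncomputable section

set_option linter.dupNamespace false

namespace Summit.NavierStokesRegularity.NavierStokesRegularity.Theorems

namespace WakeRatchetDyadicPostFiring

open Set Filter Topology

variable {Λ : ℝ} {W : ℤ → ℝ → ℝ} {A₀ A B c : ℝ}

/-- **(D′) from quiet times in the band above the energy line.**  Let `A₀ < A < σ_E`, `0 ≤ W ≤ B` and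
`W_n ≡ 0` (`n < 0`) on `σ ≥ A`, `Λ > 1`, and let `E = E(σ_E)` be the (conserved) physical energy.  If every
firing `W_n(σ₁) ≥ c` with `σ₁ ≥ σ_E` is followed by an instant `σ₀ ∈ [σ₁, σ₁ + L]` at which every shell `k ≤ n`
ABOVE THE ENERGY LINE (`η < Λ^k e^{−σ₀} √E`) satisfies `W_k(σ₀) ≤ η` (`0 ≤ η`, `4Λη ≤ 1`), then (D′) holds from
`σ_E` on with `D = max(B, 2η) e^{L}`: `W_n(σ₂) ≤ D e^{−(σ₂−σ₁)}` whenever `σ_E ≤ σ₁ ≤ σ₂`, `W_n(σ₁) ≥ c`.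
[cite: Tao2016AveragedNS, §1.2 (dyadic model, conserved energy), §4 Lemma 4.1 (4.8)/(4.10), §6.4; elementary] -/
theorem postFiringDecay_of_bandQuietTimes (hΛ : 1 < Λ) (hA : A₀ < A)
    (hlaw : ∀ (n : ℤ) (σ : ℝ), A₀ < σ → HasDerivAt (W n)
      (-(W n σ) + Λ * W (n - 1) σ ^ 2 - Λ⁻¹ * W n σ * W (n + 1) σ) σ)
    (hnn : ∀ (n : ℤ) (σ : ℝ), A ≤ σ → 0 ≤ W n σ) (hB : ∀ (n : ℤ) (σ : ℝ), A ≤ σ → W n σ ≤ B)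
    (hneg : ∀ n : ℤ, n < 0 → ∀ σ : ℝ, A ≤ σ → W n σ = 0)
    {σE : ℝ} (hσE : A < σE) {η L : ℝ} (hη : 0 ≤ η) (h4 : 4 * Λ * η ≤ 1)
    (hBAND : ∀ (n : ℕ) (σ₁ : ℝ), σE ≤ σ₁ → c ≤ W n σ₁ →
      ∃ σ₀ : ℝ, σ₁ ≤ σ₀ ∧ σ₀ ≤ σ₁ + L ∧ ∀ k : ℕ, k ≤ n →
        η < Λ ^ k * Real.exp (-σ₀)
          * Real.sqrt (∑' j : ℕ, Λ⁻¹ ^ (2 * j) * (Real.exp (2 * σE) * W j σE ^ 2)) →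
        W k σ₀ ≤ η) :
    ∀ (n : ℤ) (σ₁ σ₂ : ℝ), σE ≤ σ₁ → σ₁ ≤ σ₂ → c ≤ W n σ₁ →
      W n σ₂ ≤ max B (2 * η) * Real.exp L * Real.exp (-(σ₂ - σ₁)) := by
  have hΛ0 : 0 < Λ := by linarith
  have hA' : A₀ < σE := hA.trans hσE
  -- the hypotheses of `postFiringDecay_of_quietTimes`, from `σE` on
  have hnn' : ∀ (n : ℤ) (σ : ℝ), σE ≤ σ → 0 ≤ W n σ := fun n σ hσ => hnn n σ (hσE.le.trans hσ)
  have hB' : ∀ (n : ℤ) (σ : ℝ), σE ≤ σ → W n σ ≤ B := fun n σ hσ => hB n σ (hσE.le.trans hσ)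
  have hneg' : ∀ n : ℤ, n < 0 → ∀ σ : ℝ, σE ≤ σ → W n σ = 0 :=
    fun n hn σ hσ => hneg n hn σ (hσE.le.trans hσ)
  have hQT : ∀ (n : ℕ) (σ₁ : ℝ), σE ≤ σ₁ → c ≤ W n σ₁ →
      ∃ σ₀ : ℝ, σ₁ ≤ σ₀ ∧ σ₀ ≤ σ₁ + L ∧ ∀ k : ℕ, k ≤ n → W k σ₀ ≤ η := by
    intro n σ₁ hσ₁ hfire
    obtain ⟨σ₀, h10, h0L, hband⟩ := hBAND n σ₁ hσ₁ hfire
    refine ⟨σ₀, h10, h0L, fun k hk => ?_⟩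
    by_cases hline : η < Λ ^ k * Real.exp (-σ₀)
        * Real.sqrt (∑' j : ℕ, Λ⁻¹ ^ (2 * j) * (Real.exp (2 * σE) * W j σE ^ 2))
    · exact hband k hk hline
    · exact le_of_energy_line hΛ hA hlaw hnn hB hneg hσE (hσ₁.trans h10) k (not_lt.1 hline)
  exact postFiringDecay_of_quietTimes hΛ0 hA' hlaw hnn' hB' hneg' hη h4 hQT

end WakeRatchetDyadicPostFiring

end Summit.NavierStokesRegularity.NavierStokesRegularity.Theorems

end
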